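import Summits.SmoothPoincare4.SmoothPoincare4.Theorems.InformationMetricHadamardAhHadamardFillingFisherSphereGaussDefs
import Literature.Geometry.Lorentzian.IsometryProofs
import Literature.Geometry.Lorentzian.VolumeProofs
import Mathlib.Analysis.Calculus.ParametricIntegral
import Mathlib.Geometry.Manifold.ContMDiffMFDeriv

/-!
# Stub `stub_fisherRaoMetric` (I) of line `fisher-sphere-gauss`
(crux `InformationMetricHadamard.AhHadamardFilling`, item stmt-SmoothPoincare4-6014)

For a jointly smooth family `θ : W → (N → ℝ)` over a CLOSED Riemannian 4-manifold `(N, g_N)`,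
parametrised by a 5-manifold `W`, whose Fisher form `𝓘_θ(w)(X, Y) = ∫_N D1θ(X) · D1θ(Y) dvol`
(`fisherForm`) is positive definite, `𝓘_θ` IS a smooth Riemannian `PseudoRiemannianMetric` `G` on
`TW` with `G.val w X Y = 𝓘_θ(w)(X, Y)` (Amari–Nagaoka, *Methods of Information Geometry*, §2.2: the
metric induced by `w ↦ θ w` from the flat `L²(N, dvol)`).

* §1 (generic): DIFFERENTIATION UNDER THE INTEGRAL SIGN TO ALL ORDERS — for `G : E × M → V` jointly
  `C^∞` (`E` finite-dimensional, `M` a compact manifold with a finite Borel measure `μ`),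
  `y ↦ ∫ G(y, x) dμ(x)` is `C^∞` (`contDiffOn_integral_param`; Dieudonné (8.11.2)): the parameter
  derivative of a jointly `C^{m+1}` family is jointly `C^m` (`contMDiffOn_fderiv_param`, Mathlib's
  `ContMDiffAt.mfderiv` in trivial tangent coordinates), the first-order Leibniz rule is Mathlib's
  `hasFDerivAt_integral_of_dominated_of_fderiv_le` (`hasFDerivAt_integral_param`), induction on `n`.
* §2: `G.val w = ∫ ℓ_x ⊗ ℓ_x dμ(x)` (Bochner integral of bilinear forms, `fisherBilin`) with
  `ℓ_x = D1L θ w (φ_w w) x = D1 θ w · x`; `integral_apply` twice gives `G.val = fisherForm`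
  (`fisherBilin_apply`); symmetry is `fisherForm_comm`, nondegeneracy is `hpos`; the Riemannian
  measure of the compact `N` is finite (`riemannianVolume_lt_top_of_isCompact_holds`). Smoothness
  (`contMDiff_fisherBilin`) by the tree's criterion `contMDiffAt_bilin_iff`: in the trivialisation of
  `TW` at `w₀` the inverse coordinate change at `w` is `A = D(φ_w ∘ φ₀⁻¹)(φ₀ w)`
  (`TangentBundle.symmL_trivializationAt_eq_core`), the chain rule gives `ℓ_x ∘ A = D1L θ w₀ (φ₀ w) x`
  (`D1L_comp_coordChange`), so the section reads `w ↦ B(φ₀ w)` with `B(y) = ∫ D1L ⊗ D1L dμ`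
  (`fisherBilinChart`) jointly-smooth-integrand (`contMDiffOn_tensorSq_D1L`), `C^∞` by §1.

Plain `def`s with explicit parameters and proved lemmas only; no named facts. References:
Amari–Nagaoka (AMS 2000/2007) §2.2; J. Dieudonné, *Foundations of Modern Analysis* (1960), (8.11.2).
-/

noncomputable section

-- the prescribed namespace `Summit.<P>.<Sub>.…` duplicates `SmoothPoincare4` (P = Sub)
set_option linter.dupNamespace false

open scoped Manifold ContDiff Topology ENNReal NNReal
open Set Function MeasureTheory Topology

namespace Summit.SmoothPoincare4.SmoothPoincare4.Cruxes.AhHadamardFilling.FisherSphereGauss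

open Literature.Topology.FourManifolds (HomotopySphere)
open Literature.Geometry.Lorentzian (PseudoRiemannianMetric riemannianMeasure)

/-! ## §1 Smooth dependence of fibre integrals on a parameter -/

section ParametricIntegral

universe u

variable {E : Type u} [NormedAddCommGroup E] [NormedSpace ℝ E]
  {EM : Type*} [NormedAddCommGroup EM] [NormedSpace ℝ EM] {HM : Type*} [TopologicalSpace HM]
  {IM : ModelWithCorners ℝ EM HM} {M : Type*} [TopologicalSpace M] [ChartedSpace HM M]
  {U : Set E} {V : Type u} [NormedAddCommGroup V] [NormedSpace ℝ V] {m n : ℕ∞ω} {G : E → M → V}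

/-- Parameter slices `y ↦ G y x` of a family jointly `C^n` on `U × M` (`U` open) are `C^n` on `U`.
[folklore] -/
theorem contMDiffAt_param_slice (hU : IsOpen U)
    (hG : ContMDiffOn (𝓘(ℝ, E).prod IM) 𝓘(ℝ, V) n (uncurry G) (U ×ˢ univ)) {y : E} (hy : y ∈ U)
    (x : M) : ContMDiffAt 𝓘(ℝ, E) 𝓘(ℝ, V) n (G · x) y :=
  ((hG (y, x) ⟨hy, mem_univ _⟩).contMDiffAt ((hU.prod isOpen_univ).mem_nhds ⟨hy, mem_univ _⟩)).comp
    y (contMDiffAt_id.prodMk contMDiffAt_const)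

/-- Fibre slices `x ↦ G y x`, `y ∈ U`, of a family jointly `C^n` on `U × M` are `C^n`. [folklore] -/
theorem contMDiff_fibre_slice (hU : IsOpen U)
    (hG : ContMDiffOn (𝓘(ℝ, E).prod IM) 𝓘(ℝ, V) n (uncurry G) (U ×ˢ univ)) {y : E} (hy : y ∈ U) :
    ContMDiff IM 𝓘(ℝ, V) n (G y) := fun x ↦
  ((hG (y, x) ⟨hy, mem_univ _⟩).contMDiffAt ((hU.prod isOpen_univ).mem_nhds ⟨hy, mem_univ _⟩)).comp
    x (contMDiffAt_const.prodMk contMDiffAt_id)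

variable [IsManifold IM 1 M]

/-- **The parameter derivative of a jointly `C^{m+1}` family is jointly `C^m`**: if `(y, x) ↦ G y x`
is `C^n` on `U × M`, `m + 1 ≤ n`, then `(y, x) ↦ ∂_y G(·, x)(y) : E →L V` is `C^m` on `U × M`
(Mathlib's `ContMDiffAt.mfderiv` in the trivial tangent coordinates of `E`, `V`). [folklore] -/
theorem contMDiffOn_fderiv_param (hU : IsOpen U)
    (hG : ContMDiffOn (𝓘(ℝ, E).prod IM) 𝓘(ℝ, V) n (uncurry G) (U ×ˢ univ)) (hmn : m + 1 ≤ n) :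
    ContMDiffOn (𝓘(ℝ, E).prod IM) 𝓘(ℝ, E →L[ℝ] V) m
      (uncurry fun y x ↦ fderiv ℝ (G · x) y) (U ×ˢ univ) := by
  rintro ⟨y₀, x₀⟩ ⟨hy₀, -⟩
  have hGat : ContMDiffAt (𝓘(ℝ, E).prod IM) 𝓘(ℝ, V) n (uncurry G) (y₀, x₀) :=
    (hG (y₀, x₀) ⟨hy₀, mem_univ _⟩).contMDiffAt ((hU.prod isOpen_univ).mem_nhds ⟨hy₀, mem_univ _⟩)
  have hf : ContMDiffAt ((𝓘(ℝ, E).prod IM).prod 𝓘(ℝ, E)) 𝓘(ℝ, V) n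
      (uncurry fun (p : E × M) (y : E) ↦ G y p.2) ((y₀, x₀), y₀) :=
    hGat.comp ((y₀, x₀), y₀) (contMDiffAt_snd.prodMk contMDiffAt_fst.snd)
  have key := hf.mfderiv (fun (p : E × M) (y : E) ↦ G y p.2) Prod.fst contMDiffAt_fst hmn
  rw [inTangentCoordinates_model_space] at key
  refine (key.congr_of_eventuallyEq (Filter.Eventually.of_forall fun p ↦ ?_)).contMDiffWithinAt
  exact (mfderiv_eq_fderiv (f := fun y ↦ G y p.2) (x := p.1)).symm

variable [FiniteDimensional ℝ E] [CompactSpace M] [MeasurableSpace M] [OpensMeasurableSpace M]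
  {μ : Measure M} [IsFiniteMeasure μ]

omit [NormedSpace ℝ V] [IsManifold IM 1 M] in
/-- On a compact space with a finite measure, continuous functions are integrable. [folklore] -/
theorem integrable_of_continuous_compact {f : M → V} (hf : Continuous f) : Integrable f μ :=
  hf.integrable_of_hasCompactSupport (HasCompactSupport.of_compactSpace f)

/-- **Differentiation under the integral sign over a compact fibre**: for `G` jointly `C^1` on
`U × M` (`E` finite-dimensional, `M` compact with a finite Borel measure `μ`), `y ↦ ∫ G y x dμ(x)`
has derivative `∫ ∂_y G(·, x)(y₀) dμ(x)` at `y₀ ∈ U` — the derivative family is jointly continuous,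
hence bounded on `closedBall y₀ ε × M`, and `hasFDerivAt_integral_of_dominated_of_fderiv_le`
applies. [cite: Dieudonne1960, (8.11.2)] -/
theorem hasFDerivAt_integral_param (hU : IsOpen U)
    (hG : ContMDiffOn (𝓘(ℝ, E).prod IM) 𝓘(ℝ, V) 1 (uncurry G) (U ×ˢ univ)) {y₀ : E} (hy₀ : y₀ ∈ U) :
    HasFDerivAt (fun y ↦ ∫ x, G y x ∂μ) (∫ x, fderiv ℝ (G · x) y₀ ∂μ) y₀ := by
  have hG' := contMDiffOn_fderiv_param (m := 0) hU hG (by norm_num)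
  obtain ⟨ε, hε, hεU⟩ : ∃ ε > 0, Metric.closedBall y₀ ε ⊆ U :=
    Metric.nhds_basis_closedBall.mem_iff.1 (hU.mem_nhds hy₀)
  obtain ⟨C, hC⟩ := ((isCompact_closedBall y₀ ε).prod isCompact_univ).exists_bound_of_continuousOn
    (hG'.continuousOn.mono (prod_mono hεU Subset.rfl))
  refine hasFDerivAt_integral_of_dominated_of_fderiv_le
    (F' := fun y x ↦ fderiv ℝ (fun y' ↦ G y' x) y) (bound := fun _ ↦ C)
    (Metric.closedBall_mem_nhds y₀ hε) ?_ ?_ ?_ ?_ (integrable_const C) ?_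
  · filter_upwards [hU.mem_nhds hy₀] with y hy
    exact (integrable_of_continuous_compact (μ := μ)
      (contMDiff_fibre_slice hU hG hy).continuous).aestronglyMeasurable
  · exact integrable_of_continuous_compact (contMDiff_fibre_slice hU hG hy₀).continuous
  · exact (integrable_of_continuous_compact (μ := μ)
      (contMDiff_fibre_slice hU hG' hy₀).continuous).aestronglyMeasurable
  · exact Filter.Eventually.of_forall fun x y hy ↦ hC (y, x) ⟨hy, mem_univ _⟩
  · refine Filter.Eventually.of_forall fun x y hy ↦ ?_
    exact ((contMDiffAt_iff_contDiffAt.1 (contMDiffAt_param_slice hU hG (hεU hy) x)).differentiableAt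
      one_ne_zero).hasFDerivAt

omit [NormedAddCommGroup V] [NormedSpace ℝ V] in
/-- **`C^n` dependence of fibre integrals on parameters**: for `G` jointly `C^{n+1}` on `U × M`,
`y ↦ ∫ G y x dμ(x)` is `C^n` on `U` — induction on `n`, the derivative being `y ↦ ∫ ∂_y G dμ`
(`hasFDerivAt_integral_param`) with `∂_y G` jointly `C^n` (`contMDiffOn_fderiv_param`).
[cite: Dieudonne1960, (8.11.2)] -/
theorem contDiffOn_integral_param_nat (hU : IsOpen U) (n : ℕ) :
    ∀ {V : Type u} [NormedAddCommGroup V] [NormedSpace ℝ V] {G : E → M → V},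
      ContMDiffOn (𝓘(ℝ, E).prod IM) 𝓘(ℝ, V) ((n + 1 : ℕ) : ℕ∞ω) (uncurry G) (U ×ˢ univ) →
        ContDiffOn ℝ n (fun y ↦ ∫ x, G y x ∂μ) U := by
  induction n with
  | zero =>
    intro V _ _ G hG
    rw [Nat.cast_zero, contDiffOn_zero]
    exact fun y hy ↦
      (hasFDerivAt_integral_param hU (by simpa using hG) hy).continuousAt.continuousWithinAt
  | succ n ih =>
    intro V _ _ G hG
    have hD : ∀ y ∈ U, HasFDerivAt (fun y ↦ ∫ x, G y x ∂μ) (∫ x, fderiv ℝ (G · x) y ∂μ) y :=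
      fun y hy ↦ hasFDerivAt_integral_param hU
        (hG.of_le (by exact_mod_cast Nat.le_add_left 1 (n + 1))) hy
    have hG' : ContMDiffOn (𝓘(ℝ, E).prod IM) 𝓘(ℝ, E →L[ℝ] V) ((n + 1 : ℕ) : ℕ∞ω)
        (uncurry fun y x ↦ fderiv ℝ (G · x) y) (U ×ˢ univ) :=
      contMDiffOn_fderiv_param hU hG (by exact_mod_cast le_rfl)
    rw [Nat.cast_succ, contDiffOn_succ_iff_fderiv_of_isOpen hU]
    exact ⟨fun y hy ↦ (hD y hy).differentiableAt.differentiableWithinAt,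
      fun h ↦ absurd h (WithTop.natCast_ne_top n), (ih hG').congr fun y hy ↦ (hD y hy).fderiv⟩

/-- **Smooth dependence of fibre integrals on parameters**: for `G` jointly `C^∞` on `U × M`
(`U` open in the finite-dimensional `E`, `M` a compact manifold with a finite Borel measure `μ`),
`y ↦ ∫ G y x dμ(x)` is `C^∞` on `U`. [cite: Dieudonne1960, (8.11.2)] -/
theorem contDiffOn_integral_param (hU : IsOpen U)
    (hG : ContMDiffOn (𝓘(ℝ, E).prod IM) 𝓘(ℝ, V) ∞ (uncurry G) (U ×ˢ univ)) :
    ContDiffOn ℝ ∞ (fun y ↦ ∫ x, G y x ∂μ) U :=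
  contDiffOn_infty.2 fun n ↦ contDiffOn_integral_param_nat hU n (hG.of_le (mod_cast le_top))

end ParametricIntegral

/-! ## §2 The Fisher–Rao metric of a jointly smooth family -/

section FisherRao

variable {N : Type*} [TopologicalSpace N] [ChartedSpace (EuclideanSpace ℝ (Fin 4)) N]
  {W : Type*} [TopologicalSpace W] [ChartedSpace (EuclideanSpace ℝ (Fin 5)) W]

local notation "ℝ⁵" => EuclideanSpace ℝ (Fin 5)

/-- The **tensor square** `ℓ ⊗ ℓ : (X, Y) ↦ ℓ X · ℓ Y` of a covector on `ℝ⁵`. [folklore] -/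
def tensorSq (ℓ : ℝ⁵ →L[ℝ] ℝ) : ℝ⁵ →L[ℝ] ℝ⁵ →L[ℝ] ℝ :=
  (ℓ.precomp ℝ).comp ((ContinuousLinearMap.mul ℝ ℝ).comp ℓ)

/-- `(ℓ ⊗ ℓ)(X, Y) = ℓ X · ℓ Y`. [folklore] -/
@[simp] theorem tensorSq_apply (ℓ : ℝ⁵ →L[ℝ] ℝ) (X Y : ℝ⁵) : tensorSq ℓ X Y = ℓ X * ℓ Y := rfl

/-- The **parameter differential of `θ` read in the chart at `w₀`**, at the chart point `y`,
pointwise in `x`: `D1L θ w₀ y x = d(θ(φ_{w₀}⁻¹ ·)(x))_y`, so that `D1 θ w X x = D1L θ w (φ_w w) x X`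
definitionally. [folklore] -/
def D1L (θ : W → N → ℝ) (w₀ : W) (y : ℝ⁵) (x : N) : ℝ⁵ →L[ℝ] ℝ :=
  fderiv ℝ (fun y' ↦ chartFamily θ w₀ y' x) y

variable [IsManifold (𝓡 5) ∞ W] {θ : W → N → ℝ}
  (hθ : ContMDiff ((𝓡 5).prod (𝓡 4)) 𝓘(ℝ, ℝ) ∞ (fun p : W × N ↦ θ p.1 p.2))
include hθ

/-- The chart representative `(y, x) ↦ θ (φ_{w₀}⁻¹ y) x` of a jointly smooth family is jointly
smooth on `φ_{w₀}.target × N`. [folklore] -/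
theorem contMDiffOn_chartFamily (w₀ : W) :
    ContMDiffOn (𝓘(ℝ, ℝ⁵).prod (𝓡 4)) 𝓘(ℝ, ℝ) ∞ (uncurry (chartFamily θ w₀))
      ((extChartAt (𝓡 5) w₀).target ×ˢ univ) :=
  hθ.comp_contMDiffOn (f := fun p : ℝ⁵ × N ↦ ((extChartAt (𝓡 5) w₀).symm p.1, p.2))
    (((contMDiffOn_extChartAt_symm w₀).comp contMDiffOn_fst fun _ hp ↦ hp.1).prodMk
      contMDiffOn_snd)

/-- **Chain rule for the parameter differential under a change of chart.** For `w` in the chart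
domain of `w₀`: `D1L θ w (φ_w w) x ∘ D(φ_w ∘ φ_{w₀}⁻¹)(φ_{w₀} w) = D1L θ w₀ (φ_{w₀} w) x`.
[folklore] -/
theorem D1L_comp_coordChange {w₀ w : W} (hw : w ∈ (chartAt (EuclideanSpace ℝ (Fin 5)) w₀).source)
    (x : N) :
    (D1L θ w (extChartAt (𝓡 5) w w) x).comp
        (fderivWithin ℝ (extChartAt (𝓡 5) w ∘ (extChartAt (𝓡 5) w₀).symm) (range (𝓡 5))
          (extChartAt (𝓡 5) w₀ w)) =
      D1L θ w₀ (extChartAt (𝓡 5) w₀ w) x := by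
  have hw' : w ∈ (extChartAt (𝓡 5) w₀).source := by rwa [extChartAt_source]
  have hrange : range (𝓡 5) = univ := ModelWithCorners.range_eq_univ _
  have hinv : (extChartAt (𝓡 5) w ∘ (extChartAt (𝓡 5) w₀).symm) (extChartAt (𝓡 5) w₀ w) =
      extChartAt (𝓡 5) w w := by
    rw [Function.comp_apply, (extChartAt (𝓡 5) w₀).left_inv hw']
  -- the slice `y ↦ θ (φ_w⁻¹ y) x` is differentiable at `φ_w w`
  have hd1 : DifferentiableAt ℝ (fun y ↦ chartFamily θ w y x)
      ((extChartAt (𝓡 5) w ∘ (extChartAt (𝓡 5) w₀).symm) (extChartAt (𝓡 5) w₀ w)) := by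
    rw [hinv]
    exact (contMDiffAt_iff_contDiffAt.1 (contMDiffAt_param_slice (isOpen_extChartAt_target w)
      (contMDiffOn_chartFamily hθ w) (mem_extChartAt_target w) x)).differentiableAt (by simp)
  -- the coordinate change `φ_w ∘ φ_{w₀}⁻¹` is differentiable at `φ_{w₀} w`
  have hd2 : DifferentiableAt ℝ (extChartAt (𝓡 5) w ∘ (extChartAt (𝓡 5) w₀).symm)
      (extChartAt (𝓡 5) w₀ w) := by
    have hmem : extChartAt (𝓡 5) w₀ w ∈
        ((extChartAt (𝓡 5) w₀).symm.trans (extChartAt (𝓡 5) w)).source := by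
      rw [PartialEquiv.trans_source, PartialEquiv.symm_source, mem_inter_iff, mem_preimage,
        (extChartAt (𝓡 5) w₀).left_inv hw']
      exact ⟨(extChartAt (𝓡 5) w₀).map_source hw', mem_extChartAt_source w⟩
    have h := contDiffWithinAt_ext_coord_change (I := 𝓡 5) (n := ∞) w w₀ hmem
    rw [hrange, contDiffWithinAt_univ] at h
    exact h.differentiableAt (by simp)
  have hev : ((fun y ↦ chartFamily θ w y x) ∘ (extChartAt (𝓡 5) w ∘ (extChartAt (𝓡 5) w₀).symm))
      =ᶠ[𝓝 (extChartAt (𝓡 5) w₀ w)] fun y ↦ chartFamily θ w₀ y x := by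
    have hs : (extChartAt (𝓡 5) w).source ∈ 𝓝 ((extChartAt (𝓡 5) w₀).symm (extChartAt (𝓡 5) w₀ w)) :=
      ((extChartAt (𝓡 5) w₀).left_inv hw').symm ▸ extChartAt_source_mem_nhds w
    filter_upwards [(continuousAt_extChartAt_symm' hw').preimage_mem_nhds hs] with y hy
    simp only [Function.comp_apply, chartFamily, (extChartAt (𝓡 5) w).left_inv hy]
  have hcomp := fderiv_comp (extChartAt (𝓡 5) w₀ w) hd1 hd2
  rw [hinv] at hcomp
  unfold D1L
  rw [hrange, fderivWithin_univ, ← hcomp]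
  exact hev.fderiv_eq

variable [IsManifold (𝓡 4) ∞ N]

/-- The parameter differential `(y, x) ↦ D1L θ w₀ y x` is jointly smooth on `φ_{w₀}.target × N`
(`contMDiffOn_fderiv_param`). [folklore] -/
theorem contMDiffOn_D1L (w₀ : W) :
    ContMDiffOn (𝓘(ℝ, ℝ⁵).prod (𝓡 4)) 𝓘(ℝ, ℝ⁵ →L[ℝ] ℝ) ∞ (uncurry (D1L θ w₀))
      ((extChartAt (𝓡 5) w₀).target ×ˢ univ) :=
  contMDiffOn_fderiv_param (isOpen_extChartAt_target w₀) (contMDiffOn_chartFamily hθ w₀)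
    ENat.coe_top_add_one.le

/-- The integrand `(y, x) ↦ D1L θ w₀ y x ⊗ D1L θ w₀ y x` of the Fisher form read in the chart at `w₀`
is jointly smooth on `φ_{w₀}.target × N`. [folklore] -/
theorem contMDiffOn_tensorSq_D1L (w₀ : W) :
    ContMDiffOn (𝓘(ℝ, ℝ⁵).prod (𝓡 4)) 𝓘(ℝ, ℝ⁵ →L[ℝ] ℝ⁵ →L[ℝ] ℝ) ∞
      (uncurry fun y x ↦ tensorSq (D1L θ w₀ y x)) ((extChartAt (𝓡 5) w₀).target ×ˢ univ) := by
  have h := contMDiffOn_D1L hθ w₀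
  have key : ContMDiffOn (𝓘(ℝ, ℝ⁵).prod (𝓡 4)) 𝓘(ℝ, ℝ⁵ →L[ℝ] ℝ⁵ →L[ℝ] ℝ) ∞
      (fun p ↦ ((uncurry (D1L θ w₀) p).precomp ℝ).comp
        ((ContinuousLinearMap.mul ℝ ℝ).comp (uncurry (D1L θ w₀) p)))
      ((extChartAt (𝓡 5) w₀).target ×ˢ univ) :=
    (h.clm_precomp (F₃ := ℝ)).clm_comp (contMDiffOn_const.clm_comp h)
  exact key

variable [MeasurableSpace N]

omit hθ in
/-- **The Fisher form read in the chart at `w₀`** as a bilinear-form-valued function of the chart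
point: the Bochner integral `B_{w₀}(y) = ∫_N D1L θ w₀ y x ⊗ D1L θ w₀ y x dμ(x)`. [folklore] -/
def fisherBilinChart (μ : Measure N) (θ : W → N → ℝ) (w₀ : W) (y : ℝ⁵) : ℝ⁵ →L[ℝ] ℝ⁵ →L[ℝ] ℝ :=
  ∫ x, tensorSq (D1L θ w₀ y x) ∂μ

omit hθ in
/-- **The Fisher form at `w`** as a continuous bilinear form on `T_w W = ℝ⁵`: `B_w(φ_w w)`. [folklore] -/
def fisherBilin (μ : Measure N) (θ : W → N → ℝ) (w : W) : ℝ⁵ →L[ℝ] ℝ⁵ →L[ℝ] ℝ :=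
  fisherBilinChart μ θ w (extChartAt (𝓡 5) w w)

variable [CompactSpace N] [BorelSpace N] {μ : Measure N} [IsFiniteMeasure μ]

/-- `B_{w₀}` is `C^∞` on the chart target (`contDiffOn_integral_param`). [folklore] -/
theorem contDiffOn_fisherBilinChart (w₀ : W) :
    ContDiffOn ℝ ∞ (fisherBilinChart μ θ w₀) (extChartAt (𝓡 5) w₀).target :=
  contDiffOn_integral_param (isOpen_extChartAt_target w₀) (contMDiffOn_tensorSq_D1L hθ w₀)

/-- `B_{w₀}(y)(X, Y) = ∫ D1L(y, x) X · D1L(y, x) Y dμ(x)` for `y` in the chart target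
(`integral_apply` twice; the integrand is continuous on the compact `N`). [folklore] -/
theorem fisherBilinChart_apply (w₀ : W) {y : ℝ⁵} (hy : y ∈ (extChartAt (𝓡 5) w₀).target)
    (X Y : ℝ⁵) : fisherBilinChart μ θ w₀ y X Y = ∫ x, D1L θ w₀ y x X * D1L θ w₀ y x Y ∂μ := by
  have hint := integrable_of_continuous_compact (μ := μ)
    (contMDiff_fibre_slice (isOpen_extChartAt_target w₀) (contMDiffOn_tensorSq_D1L hθ w₀)
      hy).continuous
  rw [fisherBilinChart, ContinuousLinearMap.integral_apply hint,
    ContinuousLinearMap.integral_apply (hint.apply_continuousLinearMap X)]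
  rfl

/-- `fisherBilin μ θ w X Y = ∫ D1 θ w X · D1 θ w Y dμ`. [folklore] -/
theorem fisherBilin_apply (w : W) (X Y : ℝ⁵) :
    fisherBilin μ θ w X Y = ∫ x, D1 θ w X x * D1 θ w Y x ∂μ :=
  fisherBilinChart_apply hθ w (mem_extChartAt_target w) X Y

/-- **The Fisher bilinear form in the trivialisation at `w₀`**: for `w` in the chart domain of `w₀`
and `A = D(φ_w ∘ φ_{w₀}⁻¹)(φ_{w₀} w)`, `Aᵀ (fisherBilin w) A = B_{w₀}(φ_{w₀} w)`
(`D1L_comp_coordChange`). [folklore] -/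
theorem fisherBilin_coordChange {w₀ w : W} (hw : w ∈ (chartAt (EuclideanSpace ℝ (Fin 5)) w₀).source) :
    (ContinuousLinearMap.precomp ℝ
        (fderivWithin ℝ (extChartAt (𝓡 5) w ∘ (extChartAt (𝓡 5) w₀).symm) (range (𝓡 5))
          (extChartAt (𝓡 5) w₀ w))).comp
      ((fisherBilin μ θ w).comp
        (fderivWithin ℝ (extChartAt (𝓡 5) w ∘ (extChartAt (𝓡 5) w₀).symm) (range (𝓡 5))
          (extChartAt (𝓡 5) w₀ w))) =
    fisherBilinChart μ θ w₀ (extChartAt (𝓡 5) w₀ w) := by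
  have hw' : w ∈ (extChartAt (𝓡 5) w₀).source := by rwa [extChartAt_source]
  ext X Y
  simp only [ContinuousLinearMap.comp_apply, ContinuousLinearMap.precomp_apply]
  rw [fisherBilin, fisherBilinChart_apply hθ w (mem_extChartAt_target w),
    fisherBilinChart_apply hθ w₀ ((extChartAt (𝓡 5) w₀).map_source hw')]
  refine congrArg (integral μ) (funext fun x ↦ ?_)
  rw [← D1L_comp_coordChange hθ hw x]
  rfl

/-- **Smoothness of the Fisher form as a section of `Hom(TW, Hom(TW, ℝ))`** (criterion
`contMDiffAt_bilin_iff`): in the trivialisation of `TW` at `w₀` the section reads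
`w ↦ B_{w₀}(φ_{w₀} w)` near `w₀` (`fisherBilin_coordChange`,
`TangentBundle.symmL_trivializationAt_eq_core`), smooth by `contDiffOn_fisherBilinChart`.
[cite: AmariNagaoka2007, §2.2] -/
theorem contMDiff_fisherBilin :
    ContMDiff (𝓡 5) ((𝓡 5).prod 𝓘(ℝ, ℝ⁵ →L[ℝ] ℝ⁵ →L[ℝ] ℝ)) ∞
      (fun w : W ↦ Bundle.TotalSpace.mk' (ℝ⁵ →L[ℝ] ℝ⁵ →L[ℝ] ℝ)
        (E := fun b : W ↦ TangentSpace (𝓡 5) b →L[ℝ] TangentSpace (𝓡 5) b →L[ℝ] ℝ) w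
        (fisherBilin μ θ w)) := by
  intro w₀
  refine (Literature.Geometry.Lorentzian.contMDiffAt_bilin_iff (F := ℝ⁵)
    (V := (TangentSpace (𝓡 5) : W → Type _)) (IX := 𝓡 5) (IB := 𝓡 5) (b := fun w : W ↦ w)
    (s := fun w : W ↦ (fisherBilin μ θ w : TangentSpace (𝓡 5) w →L[ℝ] TangentSpace (𝓡 5) w →L[ℝ] ℝ))
    (x₀ := w₀)).2 ⟨contMDiffAt_id, ?_⟩
  have hB : ContMDiffAt (𝓡 5) 𝓘(ℝ, ℝ⁵ →L[ℝ] ℝ⁵ →L[ℝ] ℝ) ∞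
      (fun w ↦ fisherBilinChart μ θ w₀ (extChartAt (𝓡 5) w₀ w)) w₀ :=
    ((contDiffOn_fisherBilinChart hθ w₀).contDiffAt ((isOpen_extChartAt_target w₀).mem_nhds
      (mem_extChartAt_target w₀))).contMDiffAt.comp w₀ contMDiffAt_extChartAt
  refine hB.congr_of_eventuallyEq ?_
  filter_upwards [chart_source_mem_nhds (EuclideanSpace ℝ (Fin 5)) w₀] with w hw
  rw [TangentBundle.symmL_trivializationAt_eq_core hw, tangentBundleCore_coordChange_achart]
  exact fisherBilin_coordChange hθ hw

end FisherRao

/-- **I (`fisherRaoMetric`; the route's definition request D1 as a lemma).** For a jointly smooth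
family `θ : W → (N → ℝ)` over a closed Riemannian 4-manifold `(N, g_N)` parametrised by a
5-manifold `W`, whose Fisher form `𝓘_θ(w)(X, X) = ∫_N (D1θ X)² dvol` is positive for `X ≠ 0`, there
is a smooth Riemannian `PseudoRiemannianMetric` `G` on `TW` with `G.val w X Y = 𝓘_θ(w)(X, Y)` — the
metric induced by `w ↦ θ w` from the flat `L²(N, dvol_{g_N})` (Amari–Nagaoka §2.2; for `θ = 2√ρ`
the Fisher–Rao information metric). `G.val = fisherBilin` (`fisherBilin_apply`, finiteness of the
Riemannian measure of the compact `N` by `riemannianVolume_lt_top_of_isCompact_holds`); smoothness is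
differentiation under the integral sign to all orders in the trivialisations of `TW`
(`contMDiff_fisherBilin`). [cite: AmariNagaoka2007, §2.2] -/
theorem stub_fisherRaoMetric
    (N : Type) [TopologicalSpace N] [T2Space N] [SecondCountableTopology N] [CompactSpace N]
    [ChartedSpace (EuclideanSpace ℝ (Fin 4)) N] [IsManifold (𝓡 4) ∞ N]
    (gN : PseudoRiemannianMetric (𝓡 4) ∞ (EuclideanSpace ℝ (Fin 4)) (TangentSpace (𝓡 4) : N → Type _))
    (hgN : gN.IsRiemannian)
    (W : Type) [TopologicalSpace W] [T2Space W] [SecondCountableTopology W]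
    [ChartedSpace (EuclideanSpace ℝ (Fin 5)) W] [IsManifold (𝓡 5) ∞ W]
    (θ : W → N → ℝ) (hθ : ContMDiff ((𝓡 5).prod (𝓡 4)) 𝓘(ℝ, ℝ) ∞ (fun p : W × N ↦ θ p.1 p.2))
    (hpos : ∀ (w : W) (X : EuclideanSpace ℝ (Fin 5)), X ≠ 0 → 0 < fisherForm gN hgN θ w X X) :
    ∃ G : PseudoRiemannianMetric (𝓡 5) ∞ (EuclideanSpace ℝ (Fin 5)) (TangentSpace (𝓡 5) : W → Type _),
      G.IsRiemannian ∧ ∀ (w : W) (X Y : TangentSpace (𝓡 5) w), G.val w X Y = fisherForm gN hgN θ w X Y := by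
  letI : MeasurableSpace N := borel N
  haveI : BorelSpace N := ⟨rfl⟩
  haveI : IsFiniteMeasure (riemannianMeasure (gN.toContMDiffRiemannianMetric hgN)) :=
    ⟨Literature.Geometry.Lorentzian.riemannianVolume_lt_top_of_isCompact_holds _ le_rfl
      isCompact_univ⟩
  have hval : ∀ (w : W) (X Y : EuclideanSpace ℝ (Fin 5)),
      fisherBilin (riemannianMeasure (gN.toContMDiffRiemannianMetric hgN)) θ w X Y =
        fisherForm gN hgN θ w X Y := fun w X Y ↦ by
    rw [fisherBilin_apply hθ]
    rfl
  refine ⟨{ val := fisherBilin (riemannianMeasure (gN.toContMDiffRiemannianMetric hgN)) θ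
            symm := fun w X Y ↦ ?_
            nondegenerate := fun w X hX ↦ ?_
            contMDiff := contMDiff_fisherBilin hθ }, fun w X hX ↦ ?_, fun w X Y ↦ hval w X Y⟩
  · change fisherBilin _ θ w X Y = fisherBilin _ θ w Y X
    rw [hval, hval, fisherForm_comm]
  · by_contra hne
    have h := hpos w X hne
    rw [← hval] at h
    exact h.ne' (hX X)
  · change 0 < fisherBilin _ θ w X X
    rw [hval]
    exact hpos w X hX

end Summit.SmoothPoincare4.SmoothPoincare4.Cruxes.AhHadamardFilling.FisherSphereGauss

end
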